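import Literature.Geometry.DiscreteGeometry.TwoShellPatterns
import Literature.Geometry.DiscreteGeometry.KissingRigidity

/-!
# The integer tables behind the layering dichotomy (α) «StackedRepTS» (decomp-a2c lens-3 g23 → g24-2; critic row 443 (B)(iii), lens-4 (α))

Pure `decide` facts about the two-shell integer models `fccInt ∪ fccSecondShellInt` (scale `√2`) and `hcpInt ∪ hcpSecondShellInt` (scale `3√2`)
of `Literature.Geometry.DiscreteGeometry`, consumed by the geometric dichotomy of a clean stacked layered set at period bound `Λ₁ = 17/16`
(both in-plane periods are FIRST-SHELL pattern vectors `±p₁, ±p₂` of every environment):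
* §1 ANTIPODALITY: in the hcp first shell an antipodal pair is BASAL (coordinate sum `0`) — hcp environments layer only along the basal plane;
* §2 ANGLES: two distinct, non-antipodal first-shell vectors have integer dot `∈ {1, 0, −1}` (fcc, i.e. `60° / 90° / 120°`) resp. `∈ {9, −9}` for
  BASAL hcp pairs (`60° / 120°` only — no square layering in hcp environments): the TRIANGULAR / SQUARE dichotomy;
* §3 HEIGHTS: relative to the plane of such a pair, every pattern vector has height in a three- or five-point set: for fcc pairs with dot `±1`
  (triangular) `u · (v × w) ∈ {0, ±2}` (layer spacing `√(2/3)` in contact units), with dot `0` (square) `∈ {0, ±2, ±4}` (spacing `1/√2`, second shell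
  straight above), and every hcp table vector has coordinate sum `∈ {0, ±6}` while basal pairs have `v × w = ±(9,9,9)` (spacing `√(2/3)`).
Uses `dotInt` of `…KissingRigidity`; one new integer functional (`crossInt`); no `sorry`, no `instance` / `notation`; `[folklore]` arithmetic, kernel-decided.
-/

namespace Summit.AtomisticToContinuum.Crystallization.Theorems.ChartedPlanarOrderPatternLayerTables

open Literature.Geometry.DiscreteGeometry

/-- the integer cross product on `ℤ³`. -/
def crossInt (s t : Fin 3 → ℤ) : Fin 3 → ℤ := ![s 1 * t 2 - s 2 * t 1, s 2 * t 0 - s 0 * t 2, s 0 * t 1 - s 1 * t 0]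

/-! ## 1. Antipodal first-shell pairs -/

/-- hcp: an antipodal pair of first-shell vectors is basal (coordinate sum `0`). [folklore] -/
theorem hcpInt_antipodal_basal : ∀ v ∈ hcpInt, ∀ w ∈ hcpInt, v + w = 0 → v 0 + v 1 + v 2 = 0 := by decide

/- (`fccInt_neg_mem : ∀ v ∈ fccInt, -v ∈ fccInt` omitted at landing — `dedup.landed` ≡
`…Theorems.DefectFreeCrystallizes.Negative.TypeGap.fccInt_neg_mem`; cite that one.) -/

/-! ## 2. Angles between distinct non-antipodal first-shell vectors -/

/-- fcc first shell (squared norm `2`): dot `∈ {1, 0, −1}`, i.e. angle `60°`, `90°` or `120°`. [folklore] -/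
theorem fccInt_dot_cases : ∀ v ∈ fccInt, ∀ w ∈ fccInt, v ≠ w → v + w ≠ 0 → dotInt v w = 1 ∨ dotInt v w = 0 ∨ dotInt v w = -1 := by decide

/-- hcp first shell, BASAL pairs (squared norm `18`): dot `∈ {9, −9}`, i.e. angle `60°` or `120°` — never `90°`. [folklore] -/
theorem hcpInt_basal_dot_cases : ∀ v ∈ hcpInt, ∀ w ∈ hcpInt, v 0 + v 1 + v 2 = 0 → w 0 + w 1 + w 2 = 0 → v ≠ w → v + w ≠ 0 →
    dotInt v w = 9 ∨ dotInt v w = -9 := by decide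

/-- hcp first shell, all pairs: dot `∈ {9, 0, −9, −6, −15}` (the last two are the upper–lower pairs, cosines `−1/3`, `−5/6`). [folklore] -/
theorem hcpInt_dot_cases : ∀ v ∈ hcpInt, ∀ w ∈ hcpInt, v ≠ w → v + w ≠ 0 →
    dotInt v w = 9 ∨ dotInt v w = 0 ∨ dotInt v w = -9 ∨ dotInt v w = -6 ∨ dotInt v w = -15 := by decide

/-! ## 3. Heights of the pattern over the plane of a first-shell pair -/

/-- fcc, triangular pairs (dot `±1`): every two-shell vector has `u · (v × w) ∈ {0, 2, −2}` (`‖v × w‖² = 3`: heights `0, ±2/√3` at scale `√2`,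
i.e. `±√(2/3)` contact units). [folklore] -/
theorem fcc_heights_triangular : ∀ v ∈ fccInt, ∀ w ∈ fccInt, (dotInt v w = 1 ∨ dotInt v w = -1) →
    ∀ u ∈ fccInt ∪ fccSecondShellInt, dotInt u (crossInt v w) = 0 ∨ dotInt u (crossInt v w) = 2 ∨ dotInt u (crossInt v w) = -2 := by decide

/-- fcc, square pairs (dot `0`): `u · (v × w) ∈ {0, ±2, ±4}` (`‖v × w‖² = 4`: heights `0, ±1, ±2` at scale `√2`, i.e. `±1/√2, ±√2`). [folklore] -/
theorem fcc_heights_square : ∀ v ∈ fccInt, ∀ w ∈ fccInt, v ≠ w → v + w ≠ 0 → dotInt v w = 0 →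
    ∀ u ∈ fccInt ∪ fccSecondShellInt, dotInt u (crossInt v w) = 0 ∨ dotInt u (crossInt v w) = 2 ∨ dotInt u (crossInt v w) = -2 ∨
      dotInt u (crossInt v w) = 4 ∨ dotInt u (crossInt v w) = -4 := by decide

/-- the norms of the cross products: triangular `3`, square `4` (fcc, scale `√2`). [folklore] -/
theorem fcc_cross_sqNorm : ∀ v ∈ fccInt, ∀ w ∈ fccInt, v ≠ w → v + w ≠ 0 →
    (dotInt v w = 0 → sqNormInt (crossInt v w) = 4) ∧ (dotInt v w ≠ 0 → sqNormInt (crossInt v w) = 3) := by decide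

/-- hcp: every two-shell table vector has coordinate sum `0`, `6` or `−6` (basal normal `(1,1,1)`, heights `0, ±6/√3` at scale `3√2`,
i.e. `±√(2/3)` contact units). [folklore] -/
theorem hcp_coordSum_cases : ∀ u ∈ hcpInt ∪ hcpSecondShellInt, u 0 + u 1 + u 2 = 0 ∨ u 0 + u 1 + u 2 = 6 ∨ u 0 + u 1 + u 2 = -6 := by decide

/-- hcp, basal pairs: `v × w = ±(9, 9, 9)`. [folklore] -/
theorem hcpInt_basal_cross : ∀ v ∈ hcpInt, ∀ w ∈ hcpInt, v 0 + v 1 + v 2 = 0 → w 0 + w 1 + w 2 = 0 → v ≠ w → v + w ≠ 0 →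
    crossInt v w = ![9, 9, 9] ∨ crossInt v w = ![-9, -9, -9] := by decide

end Summit.AtomisticToContinuum.Crystallization.Theorems.ChartedPlanarOrderPatternLayerTables
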